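import Literature.NumberTheory.NumberFields.CMFieldAmbiguousClassNumber
import Literature.NumberTheory.NumberFields.ClassGroupNormSurjective
import Literature.NumberTheory.NumberFields.CMFieldRelativeClassNumberDivisibility
import HarnessLib

/-!
# Horie's criterion for an odd relative class number when `h(K⁺)` is odd: `h⁻_K` odd ⟺ `t_K ≤ 1` and
# `r(E_{K⁺}/E⁺_{K⁺}) = [K⁺ : ℚ] + t_K − 1` (Horie, *Acta Arith.* 67 (1994), Theorem 1, the case `A_{K⁺} = 1`)

Topic `NumberTheory/NumberFields`; namespace `Literature.NumberTheory.NumberFields`.  Theorem-only file (no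
definition, no named fact, no `sorry`), unconditional; a junction of `CMFieldAmbiguousClassNumber.lean` (Chevalley's
formula for `K/K⁺`, Horie's Lemma 1, Louboutin–Okazaki's Prop. 2) and `ClassGroupNormSurjective.lean`
(`h_K = h⁻_K · h_{K⁺}`).

> Horie, **Theorem 1.** "Let `K` be a CM-field.  Let `M` denote the Hilbert 2-class field over `K⁺`.  Then `h⁻_K`
> is odd if and only if the following conditions are satisfied: (1-i) `M` is cyclic over `K⁺`, i.e., `A_{K⁺}` is
> cyclic, (1-ii) `t_K = 0` or `1` and, in the case `t_K = 1`, the prime ideal of `K⁺` ramified in `K` remains prime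
> in `M`, (1-iii) `r(E_M/E*_M) = [M : ℚ] + t_K − 1."
> (Notation, p. 219: `h⁻_K = h_K/h_{K⁺}`; `A_F` the Sylow 2-subgroup of `C_F`; `r` the 2-rank; `E*_F` the totally
> positive units; `t_K` the number of prime ideals of `K⁺` ramified in `K`.)  Proof (p. 221, ⟸): "As `h_M` is odd
> by (1-i) and as `t_K = t_{KM} ≤ 1` by (1-ii), it follows from Lemma 1 and (1-iii) that
> `r(A_{KM}) = t_K − 1 + [M : ℚ] − r(E_M/E*_M) = 0`.  Hence we have `r(A⁻_K) = 0`, i.e., `2 ∤ h⁻_K`."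

HERE: the case **`A_{K⁺} = 1`, i.e. `h(K⁺)` odd, where `M = K⁺`**: then (1-i) holds, (1-ii) reads `t_K ≤ 1` (the
«remains prime in `M`» clause is void) and (1-iii) reads `r(E_{K⁺}/E*_{K⁺}) = [K⁺ : ℚ] + t_K − 1`; the proof is
Horie's Lemma 1 (ii) (tree `CMFieldAmbiguousClassNumber.lean` §5–§6: for `h(K⁺)` odd and `t_K ≤ 1`,
`#Cl_K[2] · 2 = 2^{t_K} · #(E*_{K⁺}/E²_{K⁺})`) together with `h_K = h⁻_K h_{K⁺}` (so `h⁻_K` odd ⟺ `h_K` odd ⟺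
`#Cl_K[2] = 1`) and Louboutin–Okazaki's Prop. 2 (`h⁻_K` odd ⟹ `t_K ≤ 1`).  Statements (`K : Type` a CM field with
`h(K⁺)` odd; `t = #{v : e_v(K/K⁺) ≠ 1}`, `#sign(E_{K⁺}) = 2^{r(E/E*)}`, `#(E*/E²) · #sign(E) = 2^{[K⁺:ℚ]}`,
`h⁺(K⁺) = h(K⁺) · #(E*/E²)`):

* `IsCMField.odd_classNumber_div_iff_odd_classNumber_of_odd` — `h⁻_K` odd ⟺ `h_K` odd;
* **`IsCMField.odd_classNumber_div_iff_of_odd`** — **`h⁻_K` odd ⟺ (`t = 0` and `#(E*_{K⁺}/E²_{K⁺}) = 2`) or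
  (`t = 1` and `#(E*_{K⁺}/E²_{K⁺}) = 1`)**; `IsCMField.odd_classNumber_div_iff_narrowClassNumber_eq_of_odd` — the same
  with `h⁺(K⁺) = 2 h(K⁺)`, resp. `h⁺(K⁺) = h(K⁺)`;
* **`IsCMField.odd_classNumber_div_iff_card_unitSignatures_eq_of_odd`** — Horie's wording:
  **`h⁻_K` odd ⟺ `t ≤ 1` and `#sign(E_{K⁺}) = 2^{[K⁺:ℚ] + t − 1}`**;
* corollaries: with exactly one finite prime ramified, `h⁻_K` odd ⟺ `h⁺(K⁺) = h(K⁺)` ⟺ `h⁺(K⁺)` odd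
  (`IsCMField.odd_classNumber_div_iff_narrowClassNumber_eq_of_odd_of_isUnramifiedIn`,
  `IsCMField.odd_classNumber_div_iff_odd_narrowClassNumber_of_odd_of_isUnramifiedIn`); with no finite prime ramified,
  `h⁻_K` odd ⟺ `h⁺(K⁺) = 2 h(K⁺)` (`IsCMField.odd_classNumber_div_iff_of_odd_of_forall_isUnramifiedIn`);
* **Proposition 1 in the case `L = k`**: `h(k)` odd and `r(E_k/E*_k) ≤ [k:ℚ] − 2` ⟹ every CM field `K` with `K⁺ = k`
  has `h⁻_K` even (`IsCMField.even_classNumber_div_of_card_unitSignatures_le_of_odd`).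

-- TODO(general form): Theorem 1 for arbitrary `K⁺` (the Hilbert 2-class field `M` of `K⁺`, conditions (1-i)–(1-iii))
-- needs the Hilbert 2-class field; not attempted here.

## References

* K. Horie, *On CM-fields with the same maximal real subfield*, Acta Arith. 67 (1994) 219–227, Theorem 1 and its
  proof, §1 Lemma 1, Proposition 1 (held `paper:doi-10-4064-aa-67-3-219-227`, pp. 220–222). [Horie1994]
* S. Louboutin, R. Okazaki, Acta Arith. 67 (1994) 47–62, §1 Proposition 2 (tree `CMFieldAmbiguousClassNumber.lean`).
  [LouboutinOkazaki1994]
* A. Fröhlich, M. J. Taylor, *Algebraic Number Theory*, Ch. V §1 (1.12) (`h⁺ · #sign(U) = h · 2^{r₁}`; tree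
  `NarrowClassGroup.lean`). [FrohlichTaylor1990]
-/

noncomputable section

open NumberField NumberField.IsCMField NumberField.Units IsDedekindDomain
open Module (finrank)

namespace Literature.NumberTheory.NumberFields

open Literature.Geometry.Kaehler Literature.Geometry.Kaehler.ComplexTorus

variable (K : Type) [Field K] [NumberField K] [IsCMField K]

/-! ### §1. `h⁻_K` odd ⟺ `h_K` odd ⟺ `#Cl_K[2] = 1` when `h(K⁺)` is odd -/

/-- `#G[2] = 1` iff `#G` is odd, for a finite commutative group `G` (Cauchy). [folklore] -/
private theorem card_twoTorsion_eq_one_iff_odd_card'' {G : Type*} [CommGroup G] [Finite G] :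
    Nat.card {g : G // g ^ 2 = 1} = 1 ↔ Odd (Nat.card G) := by
  classical
  haveI := Fintype.ofFinite G
  constructor
  · intro h1
    by_contra hodd
    rw [Nat.not_odd_iff_even, even_iff_two_dvd, Nat.card_eq_fintype_card] at hodd
    obtain ⟨g, hg⟩ := exists_prime_orderOf_dvd_card 2 hodd
    have hg2 : g ^ 2 = 1 := by rw [← hg]; exact pow_orderOf_eq_one g
    have hg1 : g ≠ 1 := by
      intro h; rw [h, orderOf_one] at hg; exact absurd hg (by norm_num)
    haveI : Subsingleton {g : G // g ^ 2 = 1} := (Nat.card_eq_one_iff_unique.mp h1).1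
    exact hg1 (congrArg Subtype.val
      (Subsingleton.elim (⟨g, hg2⟩ : {g : G // g ^ 2 = 1}) ⟨1, one_pow 2⟩))
  · intro hodd
    have hdvd : Nat.card {g : G // g ^ 2 = 1} ∣ Nat.card G := by
      rw [← Nat.card_congr (Equiv.subtypeEquivRight (fun g : G => by
          rw [MonoidHom.mem_ker, powMonoidHom_apply]) :
          ((powMonoidHom 2 : G →* G).ker) ≃ {g : G // g ^ 2 = 1})]
      exact Subgroup.card_subgroup_dvd_card _
    haveI : Fact (Nat.Prime 2) := ⟨Nat.prime_two⟩
    have hP : IsPGroup 2 (powMonoidHom 2 : G →* G).ker := fun g => ⟨1, Subtype.ext (by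
      have hg := g.2
      rw [MonoidHom.mem_ker, powMonoidHom_apply] at hg
      rw [pow_one, Subgroup.coe_pow, Subgroup.coe_one, hg])⟩
    obtain ⟨k, hk⟩ := IsPGroup.iff_card.mp hP
    have hk' : Nat.card {g : G // g ^ 2 = 1} = 2 ^ k := by
      rw [← hk]
      exact Nat.card_congr (Equiv.subtypeEquivRight fun g => by rw [MonoidHom.mem_ker, powMonoidHom_apply])
    rw [hk'] at hdvd ⊢
    exact Nat.Coprime.eq_one_of_dvd (Nat.Coprime.pow_left k hodd.coprime_two_left) hdvd

/-- **`h_K = h⁻_K · h_{K⁺}`** for a CM field («As is well known, the norm map `C_K → C_{K⁺}` is surjective so that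
`h⁻_K` … is an integer»). [cite: Horie1994, p. 219 (notation)] -/
theorem IsCMField.classNumber_div_mul_classNumber :
    classNumber K / classNumber (maximalRealSubfield K) * classNumber (maximalRealSubfield K) = classNumber K := by
  have h := IsCMField.card_ker_classGroupNorm_mul_card K
  rw [← IsCMField.classNumber_div_eq_card_ker] at h
  exact h

/-- **For `h(K⁺)` odd: `h⁻_K` is odd iff `h_K` is odd** (`h_K = h⁻_K h_{K⁺}`).
[cite: Horie1994, Theorem 1 (proof: «r(A⁻_K) = 0, i.e., 2 ∤ h⁻_K»)] -/
theorem IsCMField.odd_classNumber_div_iff_odd_classNumber_of_odd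
    (hodd : Odd (classNumber (maximalRealSubfield K))) :
    Odd (classNumber K / classNumber (maximalRealSubfield K)) ↔ Odd (classNumber K) := by
  constructor
  · intro h
    rw [← IsCMField.classNumber_div_mul_classNumber K]
    exact h.mul hodd
  · intro h
    rw [← IsCMField.classNumber_div_mul_classNumber K] at h
    exact (Nat.odd_mul.mp h).1

/-- For `h(K⁺)` odd: `h⁻_K` odd ⟺ `#Cl_K[2] = 1` (`r(A_K) = 0`). [cite: Horie1994, Theorem 1 (proof: «r(A_{KM}) = 0»)] -/
theorem IsCMField.odd_classNumber_div_iff_card_twoTorsion_eq_one_of_odd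
    (hodd : Odd (classNumber (maximalRealSubfield K))) :
    Odd (classNumber K / classNumber (maximalRealSubfield K)) ↔
      Nat.card {c : ClassGroup (𝓞 K) // c ^ 2 = 1} = 1 := by
  rw [IsCMField.odd_classNumber_div_iff_odd_classNumber_of_odd K hodd, card_twoTorsion_eq_one_iff_odd_card'',
    classNumber, Nat.card_eq_fintype_card]

/-! ### §2. The ramification count `t_K` in the `IsUnramifiedIn` language -/

/-- `t = 1` ⟹ there is a finite prime `v₀` of `K⁺` ramified in `K` with every other finite prime unramified.
[cite: Horie1994, §1 Lemma 1 (ii) (the case t_K = 1)] -/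
theorem IsCMField.exists_not_isUnramifiedIn_of_card_ramified_eq_one
    (ht : {v : HeightOneSpectrum (𝓞 (maximalRealSubfield K)) | v.asIdeal.ramificationIdxIn (𝓞 K) ≠ 1}.ncard = 1) :
    ∃ v₀ : HeightOneSpectrum (𝓞 (maximalRealSubfield K)), ¬ Algebra.IsUnramifiedIn (𝓞 K) v₀.asIdeal ∧
      ∀ v : HeightOneSpectrum (𝓞 (maximalRealSubfield K)), v ≠ v₀ → Algebra.IsUnramifiedIn (𝓞 K) v.asIdeal := by
  obtain ⟨v₀, hv₀⟩ := Set.ncard_eq_one.1 ht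
  refine ⟨v₀, fun h => ?_, fun v hv => ?_⟩
  · have hmem : v₀ ∈ ({v₀} : Set (HeightOneSpectrum (𝓞 (maximalRealSubfield K)))) := Set.mem_singleton v₀
    rw [← hv₀] at hmem
    exact hmem ((IsCMField.ramificationIdxIn_eq_one_iff_isUnramifiedIn K v₀).2 h)
  · by_contra hunr
    have hmem : v ∈ {v : HeightOneSpectrum (𝓞 (maximalRealSubfield K)) | v.asIdeal.ramificationIdxIn (𝓞 K) ≠ 1} :=
      fun h => hunr ((IsCMField.ramificationIdxIn_eq_one_iff_isUnramifiedIn K v).1 h)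
    rw [hv₀, Set.mem_singleton_iff] at hmem
    exact hv hmem

/-- `t = 0` ⟹ every finite prime of `K⁺` is unramified in `K`. [cite: Horie1994, §1 Lemma 1 (ii) (the case t_K = 0)] -/
theorem IsCMField.forall_isUnramifiedIn_of_card_ramified_eq_zero
    (ht : {v : HeightOneSpectrum (𝓞 (maximalRealSubfield K)) | v.asIdeal.ramificationIdxIn (𝓞 K) ≠ 1}.ncard = 0) :
    ∀ v : HeightOneSpectrum (𝓞 (maximalRealSubfield K)), Algebra.IsUnramifiedIn (𝓞 K) v.asIdeal := by
  have hfin := AmbiguousIdeal.finite_setOf_ramificationIdxIn_ne_one (K := maximalRealSubfield K) (L := K)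
  have hempty := (Set.ncard_eq_zero hfin).1 ht
  intro v
  by_contra hunr
  have hmem : v ∈ {v : HeightOneSpectrum (𝓞 (maximalRealSubfield K)) | v.asIdeal.ramificationIdxIn (𝓞 K) ≠ 1} :=
    fun h => hunr ((IsCMField.ramificationIdxIn_eq_one_iff_isUnramifiedIn K v).1 h)
  rw [hempty] at hmem
  exact hmem

/-! ### §3. Horie's Theorem 1 for `h(K⁺)` odd -/

/-- **Horie's Theorem 1 in the case `A_{K⁺} = 1` (`h(K⁺)` odd): `h⁻_K` is odd iff either no finite prime of `K⁺`
ramifies in `K` and `#(E*_{K⁺}/E²_{K⁺}) = 2`, or exactly one finite prime of `K⁺` ramifies in `K` and every totally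
positive unit of `K⁺` is a square** ((1-ii): `t_K ≤ 1`; (1-iii): `r(E_{K⁺}/E*_{K⁺}) = [K⁺:ℚ] + t_K − 1`, i.e.
`r(E*/E²) = 1 − t_K`; proof by Lemma 1 (ii): `#Cl_K[2] · 2 = 2^{t_K} · #(E*/E²)` for `t_K ≤ 1`, and `h⁻_K` odd ⟹
`t_K ≤ 1` by Louboutin–Okazaki's Prop. 2).
[cite: Horie1994, Theorem 1 (the case M = K⁺) with §1 Lemma 1 (ii)] [cite: LouboutinOkazaki1994, §1 Proposition 2] -/
theorem IsCMField.odd_classNumber_div_iff_of_odd (hodd : Odd (classNumber (maximalRealSubfield K))) :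
    Odd (classNumber K / classNumber (maximalRealSubfield K)) ↔
      ({v : HeightOneSpectrum (𝓞 (maximalRealSubfield K)) | v.asIdeal.ramificationIdxIn (𝓞 K) ≠ 1}.ncard = 0 ∧
          Nat.card (TotPosUnitsModSq (maximalRealSubfield K)) = 2) ∨
        ({v : HeightOneSpectrum (𝓞 (maximalRealSubfield K)) | v.asIdeal.ramificationIdxIn (𝓞 K) ≠ 1}.ncard = 1 ∧
          Nat.card (TotPosUnitsModSq (maximalRealSubfield K)) = 1) := by
  set t := {v : HeightOneSpectrum (𝓞 (maximalRealSubfield K)) | v.asIdeal.ramificationIdxIn (𝓞 K) ≠ 1}.ncard with ht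
  rw [IsCMField.odd_classNumber_div_iff_card_twoTorsion_eq_one_of_odd K hodd]
  constructor
  · intro h1
    have hle : t ≤ 1 := by
      have hodd' : Odd (classNumber K / classNumber (maximalRealSubfield K)) :=
        (IsCMField.odd_classNumber_div_iff_card_twoTorsion_eq_one_of_odd K hodd).2 h1
      exact IsCMField.card_ramified_le_one_of_odd_classNumber_div K hodd'
    rcases Nat.le_one_iff_eq_zero_or_eq_one.mp hle with h0 | h1'
    · left
      refine ⟨h0, ?_⟩
      have hunr := IsCMField.forall_isUnramifiedIn_of_card_ramified_eq_zero K h0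
      have h := (IsCMField.card_twoTorsion_classGroup_mul_two_eq_card_totPosUnitsModSq_of_odd_of_forall_isUnramifiedIn
        K hodd hunr).1
      rw [h1, one_mul] at h
      exact h.symm
    · right
      refine ⟨h1', ?_⟩
      obtain ⟨v₀, hv₀, hunr⟩ := IsCMField.exists_not_isUnramifiedIn_of_card_ramified_eq_one K h1'
      have h := (IsCMField.card_twoTorsion_classGroup_eq_card_totPosUnitsModSq_of_odd_of_isUnramifiedIn
        K hodd hv₀ hunr).1
      rw [h1] at h
      exact h.symm
  · rintro (⟨h0, hU⟩ | ⟨h1', hU⟩)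
    · have hunr := IsCMField.forall_isUnramifiedIn_of_card_ramified_eq_zero K h0
      have h := (IsCMField.card_twoTorsion_classGroup_mul_two_eq_card_totPosUnitsModSq_of_odd_of_forall_isUnramifiedIn
        K hodd hunr).1
      rw [hU] at h
      omega
    · obtain ⟨v₀, hv₀, hunr⟩ := IsCMField.exists_not_isUnramifiedIn_of_card_ramified_eq_one K h1'
      have h := (IsCMField.card_twoTorsion_classGroup_eq_card_totPosUnitsModSq_of_odd_of_isUnramifiedIn
        K hodd hv₀ hunr).1
      rw [hU] at h
      exact h

/-- The same in class numbers (`h⁺(K⁺) = h(K⁺) · #(E*_{K⁺}/E²_{K⁺})`): **for `h(K⁺)` odd, `h⁻_K` is odd iff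
(`t = 0` and `h⁺(K⁺) = 2 h(K⁺)`) or (`t = 1` and `h⁺(K⁺) = h(K⁺)`).**
[cite: Horie1994, Theorem 1 (the case M = K⁺)] [cite: FrohlichTaylor1990, Ch. V §1 (1.12)] -/
theorem IsCMField.odd_classNumber_div_iff_narrowClassNumber_eq_of_odd
    (hodd : Odd (classNumber (maximalRealSubfield K))) :
    Odd (classNumber K / classNumber (maximalRealSubfield K)) ↔
      ({v : HeightOneSpectrum (𝓞 (maximalRealSubfield K)) | v.asIdeal.ramificationIdxIn (𝓞 K) ≠ 1}.ncard = 0 ∧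
          narrowClassNumber (maximalRealSubfield K) = 2 * classNumber (maximalRealSubfield K)) ∨
        ({v : HeightOneSpectrum (𝓞 (maximalRealSubfield K)) | v.asIdeal.ramificationIdxIn (𝓞 K) ≠ 1}.ncard = 1 ∧
          narrowClassNumber (maximalRealSubfield K) = classNumber (maximalRealSubfield K)) := by
  have hpos := classNumber_pos (maximalRealSubfield K)
  have hn := narrowClassNumber_eq_classNumber_mul_card_totPosUnitsModSq (K := maximalRealSubfield K)
  have h2 : Nat.card (TotPosUnitsModSq (maximalRealSubfield K)) = 2 ↔
      narrowClassNumber (maximalRealSubfield K) = 2 * classNumber (maximalRealSubfield K) := by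
    rw [hn, mul_comm 2]
    exact ⟨fun h => by rw [h], fun h => Nat.eq_of_mul_eq_mul_left hpos h⟩
  have h1 : Nat.card (TotPosUnitsModSq (maximalRealSubfield K)) = 1 ↔
      narrowClassNumber (maximalRealSubfield K) = classNumber (maximalRealSubfield K) := by
    rw [hn]
    constructor
    · intro h; rw [h, mul_one]
    · intro h
      nth_rewrite 2 [← mul_one (classNumber (maximalRealSubfield K))] at h
      exact Nat.eq_of_mul_eq_mul_left hpos h
  rw [IsCMField.odd_classNumber_div_iff_of_odd K hodd, h2, h1]

/-- **Horie's Theorem 1 for `h(K⁺)` odd, in Horie's words: `h⁻_K` is odd iff `t_K ≤ 1` and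
`r(E_{K⁺}/E*_{K⁺}) = [K⁺ : ℚ] + t_K − 1`**, i.e. `#sign(E_{K⁺}) = 2^{[K⁺:ℚ] + t_K − 1}` (`#sign(E) = [E : E*] = 2^{r(E/E*)}`,
`#(E*/E²) · #sign(E) = 2^{[K⁺:ℚ]}`). [cite: Horie1994, Theorem 1 (conditions (1-ii), (1-iii); the case M = K⁺)] -/
theorem IsCMField.odd_classNumber_div_iff_card_unitSignatures_eq_of_odd
    (hodd : Odd (classNumber (maximalRealSubfield K))) :
    Odd (classNumber K / classNumber (maximalRealSubfield K)) ↔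
      {v : HeightOneSpectrum (𝓞 (maximalRealSubfield K)) | v.asIdeal.ramificationIdxIn (𝓞 K) ≠ 1}.ncard ≤ 1 ∧
        Nat.card ((unitsRange (maximalRealSubfield K)).map (signHom (maximalRealSubfield K))) =
          2 ^ (finrank ℚ (maximalRealSubfield K) +
            {v : HeightOneSpectrum (𝓞 (maximalRealSubfield K)) | v.asIdeal.ramificationIdxIn (𝓞 K) ≠ 1}.ncard - 1) := by
  have hnpos : 0 < finrank ℚ (maximalRealSubfield K) := Module.finrank_pos
  obtain ⟨m, hm⟩ : ∃ m, finrank ℚ (maximalRealSubfield K) = m + 1 := ⟨_, (Nat.sub_one_add_one_eq_of_pos hnpos).symm⟩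
  have hprod : Nat.card (TotPosUnitsModSq (maximalRealSubfield K)) *
      Nat.card ((unitsRange (maximalRealSubfield K)).map (signHom (maximalRealSubfield K))) =
        2 ^ finrank ℚ (maximalRealSubfield K) := by
    rw [card_unitSignatures_eq_card_range_signVec]
    exact card_totPosUnitsModSq_mul_card_range_signVec (K := maximalRealSubfield K)
  rw [hm, pow_succ] at hprod
  rw [IsCMField.odd_classNumber_div_iff_of_odd K hodd, hm]
  have h2pos : 0 < 2 ^ m := pow_pos two_pos m
  constructor
  · rintro (⟨h0, hU⟩ | ⟨h1, hU⟩)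
    · refine ⟨by rw [h0]; exact zero_le_one, ?_⟩
      rw [h0, add_zero, Nat.add_sub_cancel]
      rw [hU] at hprod
      omega
    · refine ⟨le_of_eq h1, ?_⟩
      rw [h1, Nat.add_sub_cancel, pow_succ]
      rw [hU, one_mul] at hprod
      exact hprod
  · rintro ⟨hle, hsig⟩
    rcases Nat.le_one_iff_eq_zero_or_eq_one.mp hle with h0 | h1
    · left
      refine ⟨h0, ?_⟩
      rw [h0, add_zero, Nat.add_sub_cancel] at hsig
      rw [hsig, mul_comm (2 ^ m) 2] at hprod
      exact Nat.eq_of_mul_eq_mul_right h2pos hprod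
    · right
      refine ⟨h1, ?_⟩
      rw [h1, Nat.add_sub_cancel, pow_succ] at hsig
      rw [hsig] at hprod
      nth_rewrite 2 [← one_mul (2 ^ m * 2)] at hprod
      exact Nat.eq_of_mul_eq_mul_right (by positivity) hprod

/-! ### §4. The two cases -/

/-- **`t_K = 1`: for `h(K⁺)` odd and exactly one finite prime `v₀` of `K⁺` ramified in `K`, `h⁻_K` is odd iff
`h⁺(K⁺) = h(K⁺)`** (every totally positive unit of `K⁺` is a square; Lemma 1 (ii): `#Cl_K[2] · h(K⁺) = h⁺(K⁺)`).
[cite: Horie1994, Theorem 1 and §1 Lemma 1 (ii) (the case t_K = 1, M = K⁺)] -/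
theorem IsCMField.odd_classNumber_div_iff_narrowClassNumber_eq_of_odd_of_isUnramifiedIn
    (hodd : Odd (classNumber (maximalRealSubfield K))) {v₀ : HeightOneSpectrum (𝓞 (maximalRealSubfield K))}
    (hv₀ : ¬ Algebra.IsUnramifiedIn (𝓞 K) v₀.asIdeal)
    (hunr : ∀ v : HeightOneSpectrum (𝓞 (maximalRealSubfield K)), v ≠ v₀ → Algebra.IsUnramifiedIn (𝓞 K) v.asIdeal) :
    Odd (classNumber K / classNumber (maximalRealSubfield K)) ↔
      narrowClassNumber (maximalRealSubfield K) = classNumber (maximalRealSubfield K) := by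
  have ht := IsCMField.card_ramified_eq_one_of_isUnramifiedIn K hv₀ hunr
  rw [IsCMField.odd_classNumber_div_iff_narrowClassNumber_eq_of_odd K hodd, ht]
  constructor
  · rintro (⟨h, -⟩ | ⟨-, h⟩)
    · exact absurd h one_ne_zero
    · exact h
  · exact fun h => Or.inr ⟨rfl, h⟩

/-- **`t_K = 1`: for `h(K⁺)` odd and exactly one finite prime of `K⁺` ramified in `K`, `h⁻_K` is odd iff `h⁺(K⁺)` is
odd** (`h⁺ = h · #(E*/E²)` with `#(E*/E²)` a power of `2`). [cite: Horie1994, Theorem 1 (the case t_K = 1, M = K⁺)] -/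
theorem IsCMField.odd_classNumber_div_iff_odd_narrowClassNumber_of_odd_of_isUnramifiedIn
    (hodd : Odd (classNumber (maximalRealSubfield K))) {v₀ : HeightOneSpectrum (𝓞 (maximalRealSubfield K))}
    (hv₀ : ¬ Algebra.IsUnramifiedIn (𝓞 K) v₀.asIdeal)
    (hunr : ∀ v : HeightOneSpectrum (𝓞 (maximalRealSubfield K)), v ≠ v₀ → Algebra.IsUnramifiedIn (𝓞 K) v.asIdeal) :
    Odd (classNumber K / classNumber (maximalRealSubfield K)) ↔ Odd (narrowClassNumber (maximalRealSubfield K)) := by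
  constructor
  · intro h
    rw [(IsCMField.odd_classNumber_div_iff_narrowClassNumber_eq_of_odd_of_isUnramifiedIn K hodd hv₀ hunr).1 h]
    exact hodd
  · intro h
    exact ((IsCMField.odd_classNumber_iff_of_odd_narrowClassNumber K h).2
      (IsCMField.card_ramified_eq_one_of_isUnramifiedIn K hv₀ hunr)) |>
      (IsCMField.odd_classNumber_div_iff_odd_classNumber_of_odd K hodd).2

/-- **`t_K = 0`: for `h(K⁺)` odd and `K/K⁺` unramified at every finite prime, `h⁻_K` is odd iff `h⁺(K⁺) = 2 h(K⁺)`**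
(`#(E*_{K⁺}/E²_{K⁺}) = 2`; Lemma 1 (ii): `#Cl_K[2] · 2 · h(K⁺) = h⁺(K⁺)`).
[cite: Horie1994, Theorem 1 and §1 Lemma 1 (ii) (the case t_K = 0, M = K⁺)] -/
theorem IsCMField.odd_classNumber_div_iff_of_odd_of_forall_isUnramifiedIn
    (hodd : Odd (classNumber (maximalRealSubfield K)))
    (hunr : ∀ v : HeightOneSpectrum (𝓞 (maximalRealSubfield K)), Algebra.IsUnramifiedIn (𝓞 K) v.asIdeal) :
    Odd (classNumber K / classNumber (maximalRealSubfield K)) ↔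
      narrowClassNumber (maximalRealSubfield K) = 2 * classNumber (maximalRealSubfield K) := by
  have ht := IsCMField.card_ramified_eq_zero_of_forall_isUnramifiedIn K hunr
  rw [IsCMField.odd_classNumber_div_iff_narrowClassNumber_eq_of_odd K hodd, ht]
  constructor
  · rintro (⟨-, h⟩ | ⟨h, -⟩)
    · exact h
    · exact absurd h zero_ne_one
  · exact fun h => Or.inl ⟨rfl, h⟩

/-- **`t_K = 0` makes `h⁺(K⁺)` even when `h⁻_K` and `h(K⁺)` are odd** (some totally positive unit of `K⁺` is not a
square). [cite: Horie1994, Theorem 1 and §1 Lemma 1 (ii) (the case t_K = 0, M = K⁺)] -/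
theorem IsCMField.even_narrowClassNumber_of_odd_of_forall_isUnramifiedIn
    (hodd : Odd (classNumber (maximalRealSubfield K)))
    (hunr : ∀ v : HeightOneSpectrum (𝓞 (maximalRealSubfield K)), Algebra.IsUnramifiedIn (𝓞 K) v.asIdeal)
    (hrel : Odd (classNumber K / classNumber (maximalRealSubfield K))) :
    Even (narrowClassNumber (maximalRealSubfield K)) := by
  rw [(IsCMField.odd_classNumber_div_iff_of_odd_of_forall_isUnramifiedIn K hodd hunr).1 hrel]
  exact even_two_mul _


/-- **Horie's Proposition 1 in the case `L = k` (`h(k)` odd): if `r(E_k/E*_k) ≤ [k : ℚ] − 2` then every CM field `K`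
with `K⁺ = k` has even relative class number** («Proposition 1. Let `L` be the Hilbert 2-class field over `k`.  Assume
that `L` is not cyclic over `k` or `r(E_L/E*_L) ≤ [L : ℚ] − 2.  Then any CM-field in `Γ` has even relative class
number»; here with `#sign(E_k) = 2^{r(E_k/E*_k)}`: `4 · #sign(E_{K⁺}) ≤ 2^{[K⁺:ℚ]}` ⟹ `h⁻_K` even).
[cite: Horie1994, Proposition 1 (the case L = k)] -/
theorem IsCMField.even_classNumber_div_of_card_unitSignatures_le_of_odd
    (hodd : Odd (classNumber (maximalRealSubfield K)))
    (hsig : Nat.card ((unitsRange (maximalRealSubfield K)).map (signHom (maximalRealSubfield K))) * 4 ≤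
      2 ^ finrank ℚ (maximalRealSubfield K)) :
    Even (classNumber K / classNumber (maximalRealSubfield K)) := by
  by_contra hne
  rw [Nat.not_even_iff_odd, IsCMField.odd_classNumber_div_iff_card_unitSignatures_eq_of_odd K hodd] at hne
  obtain ⟨hle, hcard⟩ := hne
  have hnpos : 0 < finrank ℚ (maximalRealSubfield K) := Module.finrank_pos
  obtain ⟨m, hm⟩ : ∃ m, finrank ℚ (maximalRealSubfield K) = m + 1 := ⟨_, (Nat.sub_one_add_one_eq_of_pos hnpos).symm⟩
  rw [hcard, hm] at hsig
  have h1 : 2 ^ m * 4 ≤ 2 ^ (m + 1) := by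
    refine le_trans (Nat.mul_le_mul_right 4 (Nat.pow_le_pow_right two_pos ?_)) hsig
    omega
  rw [pow_succ] at h1
  have h2 : 0 < 2 ^ m := pow_pos two_pos m
  omega

end Literature.NumberTheory.NumberFields
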